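import Summits.BirchSwinnertonDyer.Rank1Residual.SecondDescent.EmptyRecordsThree01
import Summits.BirchSwinnertonDyer.Rank1Residual.SecondDescent.ShaDivisibleFromTwoNonempty
import HarnessLib

/-!
# `BSD(E,p)` from ONE complete `p`-descent plus `EMPTY` on EVERY line of `Ш[p]` — the
# Cassels–Tate-FREE reading of instrument B-1 (cell `b2b-bsdres`, CLASS-CLOSURE instrument B-1
# `SEL3CT-ALT`, seat cc-eng-4, GEN 14; zero kit)

HONEST FRAMING (cell `b2b-bsdres`, run/shared/lean/b2b/bsd-rank1-residual/, verbatim in every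
file): the goal of the cell is to DELETE the COMBINATION-SHAPED residual classes of the
Birch–Swinnerton-Dyer formula for ALL analytic-rank `≤ 1` elliptic curves over `ℚ` — "full BSD
formula for every rank `≤ 1` curve in class `C`" assembled STRICTLY from published theorems — so
that the rank-`≤ 1` remainder becomes exactly the CONSTRUCTION-SHAPED classes, which are TYPED
(missing-input `Prop`s), NOT attempted. This is not "finishing BSD". Class-free TOOL theorems and
per-pair certificate SHAPES; NOT class theorems; nothing here is booked (the lane books); no record
is filed in this file; the second-descent outputs behind any future record are INSTRUMENTATION (E4)
/ EVIDENCE under census-lead's tier label. THEOREMS ONLY (no definition, no named fact, no `sorry`).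

## What this file does

The `EMPTY` chain of this directory (`ShaExponentFromNonDivisible` → `BSDpFromSecondDescentEmpty`
→ `EmptyRecordsThree01/02`) reads ONE second-`p`-descent `EMPTY` verdict — one class
`c ∈ Ш(E/ℚ)[p]` that is not a `p`-th multiple in `Ш` — together with the Cassels–Tate pairing
(tree named fact `exists_casselsTate_pairing`, binder `hCT`) and the exact count `#Ш[p] = p²`:
CT makes divisibility by `p` all-or-nothing on `Ш[p] ∖ 0` (`MixedVerdictsInconsistent`), so one
`EMPTY` class gives `Ш[p²] = Ш[p]`.  Instrument policy A3 `one` (run ONE cubic `η₁` of the four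
lines `η₁, η₂, η₁ ± η₂` of a two-dimensional `Sel^(3)`) is therefore an ECONOMY BOUGHT WITH `hCT`.

This file records the other side of that trade: if the instrument certifies `EMPTY` on EVERY
non-zero class of `Ш[p]` (policy `all`; for `dim Ш[3] = 2` that is FOUR cubics — one per line,
since `EMPTY` is blind to the sign of the class, `forall_nsmul_ne_neg`), then `Ш[p²] = Ш[p]` is a
one-line TAUTOLOGY (`nsmul_eq_zero_of_sq_nsmul_eq_zero_of_forall_not_divisible`: a class `x` of
order `p²` would make `p • x` a non-zero `p`-torsion `p`-th multiple) — NO Cassels–Tate pairing, no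
alternating form, no count enters that step — and `Typed.bsdp_of_card_selmer_stable` closes
`BSD(E,p)` from GZK + the one complete descent + `ord_p #Ш_an` exactly as before:

* §1 (algebra, any additive commutative group, any `n`): `EMPTY` is stable under `c ↦ -c` and under
  `c ↦ k • c` for `k` coprime to `n` (`forall_nsmul_ne_neg`, `forall_nsmul_ne_nsmul_of_coprime` — so
  `p + 1` certificates cover the `p + 1` lines of a plane `A[p]`); all-`EMPTY` ⇒ `A[n²] = A[n]`
  (indeed `A[n^(k+1)] = A[n]`); and for `p = 3` the FOUR-CERTIFICATE form
  `forall_not_divisible_three_of_four`: in a finite group with `#A[3] = 9`, classes `c₁, c₂` with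
  `3 • cᵢ = 0` and `EMPTY` on `c₁, c₂, c₁ + c₂, c₁ - c₂` ⇒ every non-zero `3`-torsion class is
  `EMPTY` (the four hypotheses already force `c₁ ≠ 0` and `c₂ ∉ ℤ∙c₁`, so `⟨c₁, c₂⟩ = A[3]` by
  `card_closure_pair_eq_sq'`, and every class is `± c₁`, `± c₂`, `± (c₁ + c₂)`, `± (c₁ - c₂)` or `0`).
* §2 (`ℚ`, analytic rank `≤ 1`, every prime, class-free): `bsdp_of_card_selmer_of_forall_not_divisible`
  — GZK + `#E(ℚ)[p] = b` + `#Sel^(p)(E/ℚ) = p^(r_an) · b · p^m` + all-`EMPTY` on `Ш[p]` +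
  `ord_p #Ш_an = m` ⇒ `BSD(E,p)` (ANY `m`: all-`EMPTY` pins `Ш[p^∞] = Ш[p]` whatever its dimension);
  `…_of_irr_…` with `b = 1` from irreducibility (Mazur).
* §3 (`p = 3`, the record shapes WITHOUT `hCT`): rank zero `#Sel₃ = 9`
  (`Three.bsdp_three_rankZero_of_card_selmerThree_eq_nine_of_four_empty`), rank one X11@3
  `#Sel₃ = 27` (`Three.bsdp_three_of_card_selmerThree_eq_27_of_four_empty`), and the literal-model
  rank-zero shape (`…_of_ainvs_…`) — the binders of `EmptyRecordsThree01/02`'s `bsdp3_b1e_·` with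
  `hCT` and `c/h3c/hndiv` REPLACED by `c₁ c₂ / h1 h2 / he₁ he₂ hadd hsub` (four `EMPTY` certificates).

## Reading for the lane (numbers, not adjectives; nothing placed, nothing asked)
(a) Named-fact inputs of an `EMPTY` record: policy `one` = {GZK, CT}; policy `all` = {GZK}. The
price of dropping CT is three more cubics per `dim Sel₃ = 2` row (`η₂`, `η₁ + η₂`, `η₁ − η₂`), each
an EXACT `Sel_alg^(3)(C) = ∅` (bnfcertify of the cubic's degree-`9` flex field). On the five B1W rows
of record (`15930u1 19656b1 13221g1 11286q1 6241a1`; `η₁`: 0.4–86 s EXACT per engine, front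
29–64 s per row, kit j138586 / j138665 / j139038) that is the `η₂` falsification pass of
`MixedVerdictsInconsistent` (a) extended to all three remaining lines — IF their flex fields certify
like `η₁`'s; on `17127b1` the lines `C₂ / C₄` of Fisher–Newton have flex fields with
`|d_F| ≈ 10^24.75` whose bnfcertify did not finish in 1.4 h (kit j130040, GEN 2): there CT is CHEAPER
than its removal. No such pass is placed or asked for here (cc-lead's call).
(b) The anomaly rule is unchanged: the Cassels–Tate pairing being a theorem, a MIXED outcome on the
four lines of a row with EXACT `#Sel₃` remains an engine error (`MixedVerdictsInconsistent`), whether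
or not a record cites `hCT`; what policy `all` buys is only that a consistent all-`EMPTY` outcome
closes the row without citing it. (c) Nothing here changes any record of record; the `bsdp3_b1e_·`
records (policy `one`, with `hCT`) stand.

References: B. Creutz, Math. Comp. 83 (2014) §1, §7 [Creutz2014]; J. H. Silverman, *AEC* X.4
[SilvermanAEC2009]; T. Fisher, R. Newton, LMS J. Comput. Math. 17 (2014) §4 [FisherNewton2014];
B. Mazur, *Modular curves and the Eisenstein ideal* (1977) III §5 [Mazur1977]; R. L. Miller 2011 §1
[Miller2011LMS].
-/

set_option autoImplicit false

noncomputable section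

open scoped Classical

open WeierstrassCurve NumberField Literature.NumberTheory.EllipticCurves
open Literature.NumberTheory.EllipticCurves.Rank1Residual
open Literature.NumberTheory.EllipticCurves.Rank1Residual.Typed
open Literature.NumberTheory.EllipticCurves.Rank1Residual.X11RankOneCertificates
open Summit.BirchSwinnertonDyer.Rank1Residual.X11b

namespace Summit.BirchSwinnertonDyer.Rank1Residual.SecondDescent

/-! ### §1. Algebra: `EMPTY` on every non-zero `n`-torsion class -/

section Algebra

variable {A : Type*} [AddCommGroup A]

/-- **All-`EMPTY` ⇒ `A[n²] = A[n]`, tautologically.** If NO non-zero `n`-torsion element of an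
additive commutative group is an `n`-th multiple, then `n² • x = 0 → n • x = 0` (else `n • x` is a
non-zero `n`-torsion `n`-th multiple). No pairing, no count, no finiteness. -/
theorem nsmul_eq_zero_of_sq_nsmul_eq_zero_of_forall_not_divisible {n : ℕ}
    (hall : ∀ c : A, n • c = 0 → c ≠ 0 → ∀ d : A, n • d ≠ c) (x : A) (hx : n ^ 2 • x = 0) :
    n • x = 0 := by
  by_contra h
  have h2 : n • (n • x) = 0 := by rwa [pow_two, mul_nsmul] at hx
  exact hall (n • x) h2 h x rfl

/-- All-`EMPTY` ⇒ `A[n^(k+1)] = A[n]` for every `k` (so `A[n^∞] = A[n]`). -/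
theorem nsmul_eq_zero_of_pow_nsmul_eq_zero_of_forall_not_divisible {n : ℕ}
    (hall : ∀ c : A, n • c = 0 → c ≠ 0 → ∀ d : A, n • d ≠ c) (k : ℕ) (x : A)
    (hx : n ^ (k + 1) • x = 0) : n • x = 0 := by
  induction k generalizing x with
  | zero => simpa using hx
  | succ k ih =>
    have h1 : n ^ (k + 1) • (n • x) = 0 := by rwa [pow_succ, mul_nsmul'] at hx
    have h2 : n ^ 2 • x = 0 := by rw [pow_two, mul_nsmul]; exact ih (n • x) h1
    exact nsmul_eq_zero_of_sq_nsmul_eq_zero_of_forall_not_divisible hall x h2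

/-- All-`EMPTY` ⇒ `A[n²] = A[n]` as subgroups. -/
theorem torsionBy_sq_eq_torsionBy_of_forall_not_divisible {n : ℕ}
    (hall : ∀ c : A, n • c = 0 → c ≠ 0 → ∀ d : A, n • d ≠ c) :
    AddSubgroup.torsionBy A ((n ^ 2 : ℕ) : ℤ) = AddSubgroup.torsionBy A (n : ℤ) := by
  ext x
  rw [AddSubgroup.torsionBy.nsmul_iff, AddSubgroup.torsionBy.nsmul_iff]
  constructor
  · exact nsmul_eq_zero_of_sq_nsmul_eq_zero_of_forall_not_divisible hall x
  · intro h
    rw [pow_two, mul_nsmul, h, smul_zero]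

/-- `EMPTY` is blind to the sign of the class: no `d` with `n • d = c` ⇒ no `d` with `n • d = -c`.
(The torsor of `-c` is the same curve with the opposite `E`-action; one certificate per LINE.) -/
theorem forall_nsmul_ne_neg {n : ℕ} {c : A} (h : ∀ d : A, n • d ≠ c) (d : A) : n • d ≠ -c := by
  intro hd
  exact h (-d) (by rw [smul_neg, hd, neg_neg])

/-- `m • c` depends only on `m mod n` when `n • c = 0` (`ℤ`-multiples). -/
theorem zsmul_eq_emod_zsmul {n : ℕ} {c : A} (hc : n • c = 0) (m : ℤ) :
    m • c = (m % (n : ℤ)) • c := by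
  have hn : (n : ℤ) • c = 0 := by rw [natCast_zsmul, hc]
  conv_lhs => rw [← Int.emod_add_mul_ediv m (n : ℤ)]
  rw [add_zsmul, mul_zsmul', hn, zsmul_zero, add_zero]

/-- `EMPTY` passes to every multiple `k • c` with `k` coprime to `n` (`1 < n`): for a prime `p`,
certificates on `c₁` and on `c₂ + k • c₁` (`k < p`) cover all `p + 1` lines of the plane
`⟨c₁, c₂⟩ ⊆ A[p]`. -/
theorem forall_nsmul_ne_nsmul_of_coprime {n : ℕ} (hn : 1 < n) {c : A} (hc : n • c = 0)
    (h : ∀ d : A, n • d ≠ c) {k : ℕ} (hk : Nat.Coprime k n) (d : A) : n • d ≠ k • c := by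
  intro hd
  obtain ⟨u, -, hu⟩ := Nat.exists_mul_mod_eq_one_of_coprime hk hn
  apply h (u • d)
  calc n • u • d = u • n • d := smul_comm _ _ _
    _ = (k * u) • c := by rw [hd, mul_comm, mul_nsmul']
    _ = (k * u % n + n * (k * u / n)) • c := by rw [Nat.mod_add_div]
    _ = c := by rw [add_nsmul, hu, one_nsmul, mul_nsmul, hc, smul_zero, add_zero]

/-- **Four certificates cover `A[3]` (`p = 3`).** In a finite additive commutative group with
`#A[3] = 9`, let `c₁, c₂` be `3`-torsion classes with `EMPTY` certificates on `c₁`, `c₂`, `c₁ + c₂`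
and `c₁ - c₂` (no `d` with `3 • d = ·`). Then EVERY non-zero `3`-torsion class is `EMPTY`. (The four
hypotheses force `c₁ ≠ 0` and `c₂ ∉ ℤ∙c₁`; hence `⟨c₁, c₂⟩ = A[3]` by `card_closure_pair_eq_sq'`, and
each class is `0`, `± c₁`, `± c₂`, `± (c₁ + c₂)` or `± (c₁ - c₂)`.) -/
theorem forall_not_divisible_three_of_four [Finite A]
    (hcard : Nat.card (AddSubgroup.torsionBy A ((3 : ℕ) : ℤ)) = 3 ^ 2) {c₁ c₂ : A}
    (h1 : (3 : ℕ) • c₁ = 0) (h2 : (3 : ℕ) • c₂ = 0) (he₁ : ∀ d : A, (3 : ℕ) • d ≠ c₁)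
    (he₂ : ∀ d : A, (3 : ℕ) • d ≠ c₂) (hadd : ∀ d : A, (3 : ℕ) • d ≠ c₁ + c₂)
    (hsub : ∀ d : A, (3 : ℕ) • d ≠ c₁ - c₂) (c : A) (hc : (3 : ℕ) • c = 0) (hc0 : c ≠ 0) (d : A) :
    (3 : ℕ) • d ≠ c := by
  -- the residues of an integer mod 3
  have hres : ∀ m : ℤ, m % 3 = 0 ∨ m % 3 = 1 ∨ m % 3 = 2 := fun m => by omega
  -- `2 • x = -x` on `3`-torsion
  have htwo : ∀ x : A, (3 : ℕ) • x = 0 → (2 : ℤ) • x = -x := by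
    intro x hx
    rw [eq_neg_iff_add_eq_zero, ← add_one_zsmul]
    rw [show (2 + 1 : ℤ) = ((3 : ℕ) : ℤ) by norm_num, natCast_zsmul, hx]
  -- every `ℤ`-multiple of a `3`-torsion class `x` is `0`, `x` or `-x`
  have hmul : ∀ x : A, (3 : ℕ) • x = 0 → ∀ m : ℤ, m • x = 0 ∨ m • x = x ∨ m • x = -x := by
    intro x hx m
    rw [zsmul_eq_emod_zsmul hx m, show (((3 : ℕ) : ℤ)) = 3 by norm_num]
    rcases hres m with h | h | h
    · left; rw [h, zero_zsmul]
    · right; left; rw [h, one_zsmul]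
    · right; right; rw [h, htwo x hx]
  -- `c₁ ≠ 0` and `c₂ ∉ ℤ∙c₁` from the four certificates
  have hc₁ : c₁ ≠ 0 := fun h => he₁ 0 (by rw [smul_zero, h])
  have hind : c₂ ∉ AddSubgroup.zmultiples c₁ := by
    intro hmem
    rw [AddSubgroup.mem_zmultiples_iff] at hmem
    obtain ⟨m, hm⟩ := hmem
    rcases hmul c₁ h1 m with h | h | h
    · exact he₂ 0 (by rw [smul_zero, ← hm, h])
    · exact hsub 0 (by rw [smul_zero, ← hm, h, sub_self])
    · exact hadd 0 (by rw [smul_zero, ← hm, h, add_neg_cancel])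
  -- `⟨c₁, c₂⟩ = A[3]`
  have hle : AddSubgroup.closure ({c₁, c₂} : Set A) ≤ AddSubgroup.torsionBy A ((3 : ℕ) : ℤ) := by
    rw [AddSubgroup.closure_le]
    intro a ha
    rcases ha with rfl | rfl
    · exact AddSubgroup.torsionBy.nsmul_iff.mpr h1
    · exact AddSubgroup.torsionBy.nsmul_iff.mpr h2
  have hEq : AddSubgroup.closure ({c₁, c₂} : Set A) = AddSubgroup.torsionBy A ((3 : ℕ) : ℤ) :=
    AddSubgroup.eq_of_le_of_card_ge hle
      (by rw [hcard, card_closure_pair_eq_sq' Nat.prime_three h1 h2 hc₁ hind])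
  -- write `c = m • c₁ + m' • c₂` and go through the nine residue pairs
  have hcmem : c ∈ AddSubgroup.closure ({c₁, c₂} : Set A) :=
    hEq ▸ AddSubgroup.torsionBy.nsmul_iff.mpr hc
  rw [AddSubgroup.mem_closure_pair] at hcmem
  obtain ⟨m, m', hmm⟩ := hcmem
  intro hd
  rw [← hmm] at hd hc0
  rcases hmul c₁ h1 m with hm | hm | hm <;> rcases hmul c₂ h2 m' with hm' | hm' | hm' <;>
    rw [hm, hm'] at hd hc0
  · exact hc0 (by rw [add_zero])
  · exact he₂ d (by rw [hd, zero_add])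
  · exact forall_nsmul_ne_neg he₂ d (by rw [hd, zero_add])
  · exact he₁ d (by rw [hd, add_zero])
  · exact hadd d hd
  · exact hsub d (by rw [hd, sub_eq_add_neg])
  · exact forall_nsmul_ne_neg he₁ d (by rw [hd, add_zero])
  · exact forall_nsmul_ne_neg hsub d (by rw [hd, neg_sub, sub_eq_neg_add])
  · exact forall_nsmul_ne_neg hadd d (by rw [hd, neg_add])

end Algebra

/-! ### §2. Over `ℚ`, analytic rank `≤ 1`, every prime: `BSD(E,p)` WITHOUT the Cassels–Tate pairing -/

section Rat

variable (W : WeierstrassCurve ℚ) [W.IsElliptic] (p : ℕ) [hp : Fact p.Prime]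

/-- **`BSD(E,p)` from one complete `p`-descent + `EMPTY` on EVERY non-zero class of `Ш[p]`,
analytic rank `≤ 1`, every prime — NO Cassels–Tate input.** Hypotheses: GZK (`hGZK`: `rank = r_an`,
`Ш` finite); `#E(ℚ)[p] = b > 0`; ONE complete descent `#Sel^(p)(E/ℚ) = p^(r_an) · b · p^m` (so
`#Ш[p] = p^m`, any `m`); EVERY non-zero `c ∈ Ш[p]` is not a `p`-th multiple in `Ш` (second
`p`-descent `EMPTY` verdicts on every line of `Ш[p]`); `#Ш(E)_an = q` with `ord_p q = m`. Then
`Ш[p²] = Ш[p]` tautologically (`nsmul_eq_zero_of_sq_nsmul_eq_zero_of_forall_not_divisible`) and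
`Typed.bsdp_of_card_selmer_stable` closes. Compare
`bsdp_of_card_selmer_of_casselsTate_of_not_divisible` (ONE `EMPTY` class + `hCT`, `m = 2`). Per
pair; not a class theorem; nothing booked. [cite: SilvermanAEC2009, Thm. X.4.2(a)]
[cite: Creutz2014, §1 and §7] [cite: Miller2011LMS, §1 and Def. 1.1] -/
theorem bsdp_of_card_selmer_of_forall_not_divisible
    (hGZK : rank_eq_analyticRank_of_analyticRank_le_one) (hr : W.analyticRank ≤ 1) {b m : ℕ}
    (htors : Nat.card (AddSubgroup.torsionBy W.toAffine.Point (p : ℤ)) = b) (hb : 0 < b)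
    (hSel : Nat.card (W.selmerGroup (p : ℤ)) = p ^ W.analyticRank * b * p ^ m)
    (hall : ∀ c : W.sha, p • c = 0 → c ≠ 0 → ∀ d : W.sha, p • d ≠ c)
    {q : ℚ} (hq : shaAn W = (q : ℂ)) (hv : padicValRat p q = m) : BSDp W p := by
  have hstab : ∀ x : W.sha, p ^ (1 + 1) • x = 0 → p ^ 1 • x = 0 := by
    intro x hx
    rw [pow_one]
    exact nsmul_eq_zero_of_sq_nsmul_eq_zero_of_forall_not_divisible hall x hx
  refine bsdp_of_card_selmer_stable W p hGZK hr (k := 1) (m := m) (b := b) ?_ hb ?_ hstab hq hv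
  · rw [pow_one]; exact htors
  · rw [pow_one, hSel]

/-- **The same with `#E(ℚ)[p] = 1` discharged by irreducibility of `E[p]`** (Mazur 1977 p. 157,
tree `natCard_torsionBy_eq_one_of_hasIrreducibleModPGaloisRep`): GZK + irr(`p`) +
`#Sel^(p)(E/ℚ) = p^(r_an + m)` + all-`EMPTY` on `Ш[p]` + `ord_p #Ш_an = m` ⇒ `BSD(E,p)`, no
Cassels–Tate input. Per pair; nothing booked. [cite: Mazur1977, Ch. III §5, p. 157]
[cite: SilvermanAEC2009, Thm. X.4.2(a)] [cite: Miller2011LMS, §1 and Def. 1.1] -/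
theorem bsdp_of_irr_of_card_selmer_of_forall_not_divisible
    (hGZK : rank_eq_analyticRank_of_analyticRank_le_one) (hr : W.analyticRank ≤ 1)
    (hirr : Irr W p) {m : ℕ} (hSel : Nat.card (W.selmerGroup (p : ℤ)) = p ^ (W.analyticRank + m))
    (hall : ∀ c : W.sha, p • c = 0 → c ≠ 0 → ∀ d : W.sha, p • d ≠ c)
    {q : ℚ} (hq : shaAn W = (q : ℂ)) (hv : padicValRat p q = m) : BSDp W p :=
  bsdp_of_card_selmer_of_forall_not_divisible W p hGZK hr
    (natCard_torsionBy_eq_one_of_hasIrreducibleModPGaloisRep W p hirr) Nat.one_pos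
    (by rw [hSel, pow_add, mul_one]) hall hq hv

/-- **`p = 3`, four certificates, class-free, any analytic rank `≤ 1`.** GZK + `#E(ℚ)[3] = b > 0` +
`#Sel^(3)(E/ℚ) = 3^(r_an) · b · 9` (so `#Ш[3] = 9`) + `3`-torsion classes `c₁, c₂ ∈ Ш` with `EMPTY`
certificates on `c₁, c₂, c₁ + c₂, c₁ - c₂` + `ord₃ #Ш_an = 2` ⇒ `BSD(E,3)` — NO Cassels–Tate input
(`forall_not_divisible_three_of_four` supplies the all-`EMPTY` hypothesis of
`bsdp_of_card_selmer_of_forall_not_divisible`). Per pair; nothing booked.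
[cite: SilvermanAEC2009, Thm. X.4.2(a)] [cite: Creutz2014, §1 and §7]
[cite: Miller2011LMS, §1 and Def. 1.1] -/
theorem bsdp_three_of_card_selmer_of_four_empty
    (hGZK : rank_eq_analyticRank_of_analyticRank_le_one) (hr : W.analyticRank ≤ 1) {b : ℕ}
    (htors : Nat.card (AddSubgroup.torsionBy W.toAffine.Point ((3 : ℕ) : ℤ)) = b) (hb : 0 < b)
    (hSel : Nat.card (W.selmerGroup ((3 : ℕ) : ℤ)) = 3 ^ W.analyticRank * b * 3 ^ 2)
    {c₁ c₂ : W.sha} (h1 : (3 : ℕ) • c₁ = 0) (h2 : (3 : ℕ) • c₂ = 0)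
    (he₁ : ∀ d : W.sha, (3 : ℕ) • d ≠ c₁) (he₂ : ∀ d : W.sha, (3 : ℕ) • d ≠ c₂)
    (hadd : ∀ d : W.sha, (3 : ℕ) • d ≠ c₁ + c₂) (hsub : ∀ d : W.sha, (3 : ℕ) • d ≠ c₁ - c₂)
    {q : ℚ} (hq : shaAn W = (q : ℂ)) (hv : padicValRat 3 q = 2) : BSDp W 3 := by
  haveI : Fact (Nat.Prime 3) := ⟨Nat.prime_three⟩
  obtain ⟨hrank, hfin⟩ := hGZK W hr
  haveI : Finite W.sha := hfin
  -- transport the computable `DecidableEq ℚ` of the binder to the classical one (as in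
  -- `BSDpFromSecondDescentEmpty.lean`)
  have hinst : (instDecidableEqRat : DecidableEq ℚ) = fun a b => Classical.propDecidable (a = b) :=
    Subsingleton.elim _ _
  have htors' := htors
  rw [hinst] at htors'
  -- `#Ш[3] = 9` from the one complete descent
  have hcard : Nat.card (AddSubgroup.torsionBy W.sha ((3 : ℕ) : ℕ)) = 3 ^ 2 :=
    card_torsionBy_sha_eq_of_card_selmerGroup W 3 (a := 3 ^ W.analyticRank * b)
      (by rw [hrank, htors']) (Nat.mul_pos (pow_pos (by norm_num) _) hb) hSel
  exact bsdp_of_card_selmer_of_forall_not_divisible W 3 hGZK hr htors hb hSel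
    (forall_not_divisible_three_of_four hcard h1 h2 he₁ he₂ hadd hsub) hq hv

end Rat

/-! ### §3. `p = 3`: the record shapes of `EmptyRecordsThree01/02` with `hCT` replaced by four certificates -/

section Three

/-- **Analytic rank ZERO, `p = 3`, `E[3]` irreducible, `#Sel^(3)(E/ℚ) = 9` EXACT, FOUR
second-`3`-descent `EMPTY` certificates (`c₁, c₂, c₁ + c₂, c₁ - c₂`), `ord₃ #Ш_an = 2` ⇒ `BSD(E,3)`
— NO Cassels–Tate input.** These are the binders `hGZK / hr / hirr / h3 / hs / hv` of the records
`bsdp3_b1e_·` (`EmptyRecordsThree01/02`) with `hCT` and `c / h3c / hndiv` REPLACED by the four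
certificates (instrument policy `all`: cubics `η₁, η₂, η₁ + η₂, η₁ − η₂`). Per pair; nothing booked;
no such record is filed in this file. [cite: Mazur1977, Ch. III §5, p. 157]
[cite: SilvermanAEC2009, Thm. X.4.2(a)] [cite: Creutz2014, §1 and §7]
[cite: Miller2011LMS, §1 and Def. 1.1] -/
theorem Three.bsdp_three_rankZero_of_card_selmerThree_eq_nine_of_four_empty
    (hGZK : rank_eq_analyticRank_of_analyticRank_le_one) (W : WeierstrassCurve ℚ) [W.IsElliptic]
    (hr : W.analyticRank = 0) (hirr : Irr W 3) (h3 : Nat.card (W.selmerGroup (3 : ℤ)) = 9)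
    {c₁ c₂ : W.sha} (h1 : 3 • c₁ = 0) (h2 : 3 • c₂ = 0)
    (he₁ : ∀ d : W.sha, 3 • d ≠ c₁) (he₂ : ∀ d : W.sha, 3 • d ≠ c₂)
    (hadd : ∀ d : W.sha, 3 • d ≠ c₁ + c₂) (hsub : ∀ d : W.sha, 3 • d ≠ c₁ - c₂)
    {s : ℚ} (hs : shaAn W = (s : ℂ)) (hv : padicValRat 3 s = 2) : BSDp W 3 :=
  haveI : Fact (Nat.Prime 3) := ⟨Nat.prime_three⟩
  bsdp_three_of_card_selmer_of_four_empty W hGZK (by rw [hr]; norm_num)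
    (natCard_torsionBy_eq_one_of_hasIrreducibleModPGaloisRep W 3 hirr) Nat.one_pos
    (by rw [hr, show ((3 : ℕ) : ℤ) = 3 by norm_num, h3]; norm_num) h1 h2 he₁ he₂ hadd hsub hs hv

/-- **X11 at `p = 3`, analytic rank ONE (`IsX11Three W`): `#Sel^(3)(E/ℚ) = 27` EXACT + FOUR
second-`3`-descent `EMPTY` certificates + `ord₃ #Ш_an = 2` ⇒ `BSD(E,3)` — NO Cassels–Tate input**
(the binders of `Three.bsdp_three_of_card_selmerThree_eq_27_of_casselsTate_of_not_divisible` with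
`hCT` and the one class replaced by four certificates). Per pair; X11 ∧ `r = 1` ∧ `p = 3` stays
CONSTRUCTION-SHAPED; nothing booked. [cite: SilvermanAEC2009, Thm. X.4.2(a)]
[cite: Creutz2014, §1 and §7] [cite: Miller2011LMS, §1 and Def. 1.1] -/
theorem Three.bsdp_three_of_card_selmerThree_eq_27_of_four_empty
    (hGZK : rank_eq_analyticRank_of_analyticRank_le_one) (W : WeierstrassCurve ℚ) [W.IsElliptic]
    (hX : IsX11Three W) (h3 : Nat.card (W.selmerGroup (3 : ℤ)) = 27)
    {c₁ c₂ : W.sha} (h1 : 3 • c₁ = 0) (h2 : 3 • c₂ = 0)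
    (he₁ : ∀ d : W.sha, 3 • d ≠ c₁) (he₂ : ∀ d : W.sha, 3 • d ≠ c₂)
    (hadd : ∀ d : W.sha, 3 • d ≠ c₁ + c₂) (hsub : ∀ d : W.sha, 3 • d ≠ c₁ - c₂)
    {s : ℚ} (hs : shaAn W = (s : ℂ)) (hv : padicValRat 3 s = 2) : BSDp W 3 :=
  haveI : Fact (Nat.Prime 3) := ⟨Nat.prime_three⟩
  bsdp_three_of_card_selmer_of_four_empty W hGZK hX.rank.le
    (natCard_torsionBy_eq_one_of_hasIrreducibleModPGaloisRep W 3 hX.irr) Nat.one_pos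
    (by rw [hX.rank, show ((3 : ℕ) : ℤ) = 3 by norm_num, h3]; norm_num) h1 h2 he₁ he₂ hadd hsub hs hv

/-- **B-1 policy-`all` reading for a literal model, analytic rank `0`, `p = 3`.** For integers
`a₁,…,a₆` with `discOf [a₁,…,a₆] ≠ 0` (so `⟨a₁,…,a₆⟩` is an elliptic curve over `ℚ`,
`isElliptic_of_discOf_ne_zero`): GZK + `r_an = 0` + `E[3]` irreducible + `#Sel^(3)(E/ℚ) = 9` +
`3`-torsion classes `c₁, c₂ ∈ Ш(E/ℚ)` with FOUR `EMPTY` certificates (`c₁, c₂, c₁ + c₂, c₁ - c₂`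
not third multiples in `Ш`) + `#Ш_an = s` with `ord₃ s = 2` ⟹ `BSD(E,3)`, NO Cassels–Tate input —
the literal-model twin of
`bsdp_three_rankZero_of_ainvs_of_card_selmerThree_eq_nine_of_casselsTate_of_not_divisible`
(`EmptyRecordsThree01` §1). Per pair; nothing booked. [cite: Mazur1977, Ch. III §5, p. 157]
[cite: SilvermanAEC2009, Thm. X.4.2(a)] [cite: Creutz2014, §1 and §7]
[cite: Miller2011LMS, §1 and Def. 1.1] -/
theorem bsdp_three_rankZero_of_ainvs_of_card_selmerThree_eq_nine_of_four_empty
    (hGZK : rank_eq_analyticRank_of_analyticRank_le_one)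
    (a1 a2 a3 a4 a6 : ℤ) (hΔ : discOf [a1, a2, a3, a4, a6] ≠ 0)
    (hr : (⟨a1, a2, a3, a4, a6⟩ : WeierstrassCurve ℚ).analyticRank = 0)
    (hirr : Irr (⟨a1, a2, a3, a4, a6⟩ : WeierstrassCurve ℚ) 3)
    (h3 : Nat.card ((⟨a1, a2, a3, a4, a6⟩ : WeierstrassCurve ℚ).selmerGroup (3 : ℤ)) = 9)
    {c₁ c₂ : (⟨a1, a2, a3, a4, a6⟩ : WeierstrassCurve ℚ).sha} (h1 : 3 • c₁ = 0) (h2 : 3 • c₂ = 0)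
    (he₁ : ∀ d : (⟨a1, a2, a3, a4, a6⟩ : WeierstrassCurve ℚ).sha, 3 • d ≠ c₁)
    (he₂ : ∀ d : (⟨a1, a2, a3, a4, a6⟩ : WeierstrassCurve ℚ).sha, 3 • d ≠ c₂)
    (hadd : ∀ d : (⟨a1, a2, a3, a4, a6⟩ : WeierstrassCurve ℚ).sha, 3 • d ≠ c₁ + c₂)
    (hsub : ∀ d : (⟨a1, a2, a3, a4, a6⟩ : WeierstrassCurve ℚ).sha, 3 • d ≠ c₁ - c₂)
    {s : ℚ} (hs : shaAn (⟨a1, a2, a3, a4, a6⟩ : WeierstrassCurve ℚ) = (s : ℂ))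
    (hv : padicValRat 3 s = 2) :
    BSDp (⟨a1, a2, a3, a4, a6⟩ : WeierstrassCurve ℚ) 3 := by
  haveI := isElliptic_of_discOf_ne_zero a1 a2 a3 a4 a6 hΔ
  exact Three.bsdp_three_rankZero_of_card_selmerThree_eq_nine_of_four_empty hGZK _ hr hirr h3 h1 h2
    he₁ he₂ hadd hsub hs hv

end Three

end Summit.BirchSwinnertonDyer.Rank1Residual.SecondDescent

end
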